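import Mathlib

/-! # `Balaban1983to89.B5Projector144` — the two operators called "the projection operator R" in B5 Sect. C,
(1.38) and (1.44), kernel-checked at operator level (GAPS row G-adv4-11; C-B5-8, C-adv4-34)

CITATION HEADER. Supports GAPS row G-adv4-11 (adversarial reader `b2b-balaban-adv4-g11`, cell pub-balaban) on
T. Bałaban, *Propagators and renormalization transformations for lattice gauge theories. I*, Commun. Math. Phys.
95 (1984) 17–40 [`Balaban1984PropagatorsI`], Sect. C "Change of gauge", pp. 22–26 (renders
`…/1984-cmp95-propagators-rt-I-p006-x2.png`, `-p008-x2.png`, `-p009-x2.png`, `-p010-x2.png`, read as images).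

WHAT IS PRINTED.  p. 22 [PDF 6]: "Now we use spectral properties of the Laplace operator Δ on the torus T_η. It is
a symmetric, non-negative operator, and 0 is its eigenvalue. Constant functions form the eigenspace corresponding to
the eigenvalue 0, and on the subspace orthogonal to constant functions the operator Δ is positive. Hence it is an
invertible operator and by Δ⁻¹ we denote its inverse on this subspace. We extend it to the whole space by linearity,
putting its value on constant functions equal to 0. Let us notice further that the operator Q′_k transforms constant
functions on the η-lattice into constant functions on the unit lattice, and similarly for the orthogonal subspaces.
This implies the corresponding property for Q′_k*, and for other operators constructed with the help of these
mentioned above."  …  "The operator Δ⁻² is positive on the subspace orthogonal to constant functions, hence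
Q′_kΔ⁻²Q′_k* is positive also on the corresponding subspace on the unit lattice. Because ω belongs to the subspace,
so ω = (Q′_kΔ⁻²Q′_k*)⁻¹Q′_kΔ⁻¹∂*A …".  p. 24 [PDF 8]: "Let us denote the projection operator by R, so we have
R = I − Δ⁻¹Q′_k*Q′_kΔ⁻²Q′_k*)⁻¹Q′_kΔ⁻¹. (1.38)" (sic: the opening parenthesis before Q′_kΔ⁻² is missing in print,
GAPS G-B5-14 (i); read R = I − Δ⁻¹Q′_k*(Q′_kΔ⁻²Q′_k*)⁻¹Q′_kΔ⁻¹).  p. 25 [PDF 9] ll. 1–5: "The projection operator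
R has a clear meaning. It is an orthogonal projection on the linear subspace ΔN(Q′_k) of L²(T_η),
N(Q′_k) = {λ : Q′_kλ = 0}. Indeed RΔλ = Δλ if Q′_kλ = 0, and if Rω = ω then Δ₀Q′_kΔ⁻¹ω = 0, and taking λ = Δ⁻¹ω we
have ω = Δλ and Q′_kλ = 0. Let us denote this subspace by R also, R = ΔN(Q′_k)."  p. 25: "with a > 0 (we will take
eventually a = 1), and let us denote Δ′_a = Δ + aQ′_k*Q′_k = Δ + aP′_k. … its inverse is a bounded operator G′_k …
we get the following formulas for the minimizing function λ₀,  λ₀ = G′_k∂*A − G′_k²Q′_k*(Q′_kG′_k²Q′_k*)⁻¹Q′_kG′_k∂*A,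
(1.43)  and for the projection operator R   R = I − G′_kQ′_k*(Q′_kG′_k²Q′_k*)⁻¹Q′_kG′_k. (1.44)  Now all the operators
appearing in these formulas are well defined. We have to verify it only for (Q′_kG′_k²Q′_k*)⁻¹. It is enough to prove
that Q′_kG′_k²Q′_k* is positive definite."  p. 26 [PDF 10] (text after (1.45)) ll. 5–7: "The operator R given by (1.44) is of course by
definition independent of a and we can take arbitrary a in the representation, e.g. a = 1, which is most convenient
for bounds."  (1.20) p. 20 [PDF 4]: "(Q′_kλ)(y) = Σ_{x∈B^k(y)} η^dλ(x)" (blocks of η-volume (L^kη)^d = 1, so Q′_k1 = 1).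

TYPING.  Two abstract real inner-product spaces: `E` (scalar functions on T_η, the space both R's act on) and `F`
(functions on the unit lattice T₁^{(k)}, the target of Q′_k).  `one : E`, `one' : F` are the constant functions 1.
`proj1 one` is the orthogonal projector onto ℝ·1.  The printed inputs are HYPOTHESIS BUNDLES, field by field the
sentences quoted above: `LapData one Δ Δi` (Δ symmetric, Δ1 = 0, Δ⁻¹ = `Δi` the inverse on 1^⊥ extended by 0 on
constants: ΔΔ⁻¹ = Δ⁻¹Δ = I − proj1, Δ⁻¹1 = 0 — p. 22); `AvgData one one' q qs` (Q′_k* = `qs` is the adjoint of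
Q′_k = `q`; Q′_k1 = 1 by (1.20); "similarly for the orthogonal subspaces": Q′_k(1^⊥) ⊆ 1^⊥ — p. 22); the operator
(Q′_kΔ⁻²Q′_k*)⁻¹ = `ci` enters only through `hci` : it is a right inverse of Q′_kΔ⁻²Q′_k* on 1^⊥ (p. 22 "positive …
on the corresponding subspace"; `P138_eq_of_rightInv`: (1.38) does not depend on which right inverse);
`GreenData Δ q qs a g c₂` (G′_k = `g` is the two-sided inverse of Δ′_a = Δ + aQ′_k*Q′_k, (Q′_kG′_k²Q′_k*)⁻¹ = `c₂` the
two-sided inverse of Q′_kG′_k²Q′_k* — p. 25).  No finite-dimensionality, no positivity and no lattice structure is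
used: everything below is dimension-free linear algebra over these identities (whence [folklore] tags on the
algebra, [cite:] tags on the transcribed formulas).  `hypotheses_satisfiable` records that the four bundles are
jointly satisfiable with 1 ≠ 0 (on the degenerate one-point torus E = F = ℝ); the non-degenerate instances are
Bałaban's lattice operators themselves, by exactly the quoted sentences of p. 22 / p. 25 (facts (F1)–(F3) of GAPS
C-adv4-33) — NOT constructed here.

WHAT THIS FILE CERTIFIES (kernel; value = located print defects of G-adv4-11 settled + the p. 26 a-independence
sentence proved, NOT summit progress; downstream harmless — see 4).
1. THE CLAUSE p. 25 ll. 2–5 FOR THE OPERATOR (1.38).  `R138_lap`: "RΔλ = Δλ if Q′_kλ = 0" ✓ (uses N(Q′_k) ⊆ 1^⊥,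
   `AvgData.inner_one_of_ker`, the unprinted fact (F1) of C-adv4-33, derived here from p. 22's "similarly for the
   orthogonal subspaces").  `R138_fix_iff`: Rω = ω ⟺ Q′_kΔ⁻¹ω = 0 — G-adv4-11 (i): the printed factor Δ₀ is idle;
   `R138_fix_iff_unitLap`: with ANY operator Δ₀ injective on 1^⊥(T₁^{(k)}) the printed form "Δ₀Q′_kΔ⁻¹ω = 0" is
   equivalent, so (i) is cosmetic.  G-adv4-11 (ii) is real: `R138_one` R1 = 1, `one_ne_lap` 1 ∉ ΔE ⊇ ΔN(Q′_k), hence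
   `printed_clause_fails`: ω = 1 satisfies Rω = ω but is not of the form Δλ, Q′_kλ = 0; exactly,
   `R138_fix_iff_exists`: {ω : Rω = ω} = ΔN(Q′_k) ⊕ ℝ·1, and the REPAIRED sentence `R138_fix_iff_of_orth`: "if Rω = ω
   and ω ⊥ 1 then ω = Δλ with Q′_kλ = 0".  `R138_idem`, `R138_symm`: (1.38) is an orthogonal projection (p. 22 "It is
   easy to verify that the operator I − Δ⁻¹Q′_k*(Q′_kΔ⁻²Q′_k*)⁻¹Q′_kΔ⁻¹ is a projection") — onto ΔN(Q′_k) ⊕ ℝ·1.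
2. THE OPERATOR (1.44).  `R144_fix_iff_exists`: {ω : Rω = ω} = ΔN(Q′_k) exactly, for every a (the sentence "R =
   ΔN(Q′_k)" is literally true for (1.44)); `P144_one`/`R144_one`: P_a1 = 1, R1 = 0; `R144_idem`, `R144_symm`;
   `R144_indep`: p. 26 "The operator R given by (1.44) is of course by definition independent of a" PROVED (two
   systems (a, G′, (Q′G′²Q′*)⁻¹), (a′, …) give the same R), via `eq_of_symm_idem_fix` (an orthogonal projection is
   determined by its fixed vectors).  The minimiser (1.43): `lambda0` (literal transcription), `q_lambda0` Q′_kλ₀ = 0,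
   `lap_lambda0` Δλ₀ = Δ′_aλ₀ = R∂*A, `residual_143` ∂*A − Δ′_aλ₀ = (I − R)∂*A, and the completing-the-square identity
   behind (1.42) ⇒ (1.43)–(1.44) (C-adv4-33 (F2), C-adv4-34): `norm_sq_split_142` ‖f − Δ′_aλ‖² = ‖Δ(λ₀ − λ)‖² +
   ‖(I − R)f‖² on N(Q′_k), `norm_sq_at_lambda0`, `inf_142`.
3. THE TWO R's COMPARED (G-adv4-11 (ii), C-B5-8 "projects onto ΔN(Q′_k) ⊕ ℝ·1, which agrees with the stated
   projection on 1^⊥"): `R138_eq_R144_add_proj1` — R₍₁.₃₈₎ = R₍₁.₄₄₎ + proj1 as operators on all of L²(T_η) (they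
   differ by the rank-one orthogonal projector onto constants), `R138_eq_R144_of_orth` — they coincide on 1^⊥.
4. CONSUMERS.  R is only ever applied to ∂*A-type fields (B5 (1.39), (1.46)–(1.50); B6 (2.78), (2.107)–(2.110); B9
   Sect. D, `B9FrakGPos` hypothesis `r`), which are ⊥ 1 (`inner_one_lap`-type: ⟨1, Δλ⟩ = ⟨Δ1, λ⟩ = 0; for ∂* this is
   (∂*A)~(0) = 0, p. 24), where item 3 says the two definitions agree; in (1.48) the constraint "Rλ = λ" differs
   between the two R's by a constant component of λ, invisible to ∂λ and to ⟨λ, R∂*A⟩.  So G-adv4-11 is confirmed NOT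
   load-bearing, now by kernel: a typed R must be (1.44) (= `R144`, a-independent, R1 = 0) or (1.38) restricted to 1^⊥.
NOT HERE: existence/positivity of the inverses (Δ on N(Q′_k) "as it follows from [2]", Q′_kG′_k²Q′_k* > 0, the bounds
γ₀ ≤ Q′_kG′_k²Q′_k* ≤ γ₁ and (1.45) — G-B5-13, `B5.lean`, `B5Strip145*.lean`), the Gaussian integrals (1.24)–(1.28),
(1.39)–(1.41) and δ_R (G-adv4-10), finite-dimensionality.  Elementary linear algebra; [folklore]. -/

namespace Literature.MathematicalPhysics.QuantumFieldTheory.Balaban1983to89.B5Projector144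

variable {E F : Type*} [NormedAddCommGroup E] [InnerProductSpace ℝ E] [NormedAddCommGroup F]
  [InnerProductSpace ℝ F]

/-! ### Constants and the orthogonal projector onto them -/

/-- The orthogonal projector onto the constants ℝ·1 of L²(T_η): π₁x = (⟨1, x⟩/⟨1, 1⟩)·1 (`one` = the constant
function 1; for `one = 0` this is the zero map). [folklore] -/
noncomputable def proj1 (one : E) : E →ₗ[ℝ] E where
  toFun x := (inner ℝ one x / inner ℝ one one) • one
  map_add' x y := by
    simp only [inner_add_right, add_div, add_smul]
  map_smul' t x := by
    simp only [real_inner_smul_right, RingHom.id_apply, mul_div_assoc, smul_smul]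

/-- Unfolding of `proj1`. [folklore] -/
theorem proj1_apply (one x : E) : proj1 one x = (inner ℝ one x / inner ℝ one one) • one := rfl

/-- ⟨1, π₁x⟩ = ⟨1, x⟩. [folklore] -/
theorem inner_one_proj1 {one : E} (hone : one ≠ 0) (x : E) :
    inner ℝ one (proj1 one x) = inner ℝ one x := by
  rw [proj1_apply, real_inner_smul_right, div_mul_cancel₀ _ (inner_self_ne_zero.mpr hone)]

/-- x − π₁x ⊥ 1. [folklore] -/
theorem inner_one_sub_proj1 {one : E} (hone : one ≠ 0) (x : E) :
    inner ℝ one (x - proj1 one x) = 0 := by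
  rw [inner_sub_right, inner_one_proj1 hone, sub_self]

/-- π₁ kills 1^⊥. [folklore] -/
theorem proj1_eq_zero_of_inner (one x : E) (hx : inner ℝ one x = 0) : proj1 one x = 0 := by
  rw [proj1_apply, hx, zero_div, zero_smul]

/-- π₁x = 0 ⇒ x ⊥ 1 (for 1 ≠ 0). [folklore] -/
theorem inner_eq_zero_of_proj1_eq_zero {one : E} (hone : one ≠ 0) (x : E) (hx : proj1 one x = 0) :
    inner ℝ one x = 0 := by
  have h := inner_one_proj1 hone x
  rw [hx, inner_zero_right] at h
  exact h.symm

/-- π₁ fixes the constants. [folklore] -/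
theorem proj1_smul_one {one : E} (hone : one ≠ 0) (t : ℝ) : proj1 one (t • one) = t • one := by
  rw [proj1_apply, real_inner_smul_right, mul_div_assoc, div_self (inner_self_ne_zero.mpr hone), mul_one]

/-- π₁1 = 1. [folklore] -/
theorem proj1_one {one : E} (hone : one ≠ 0) : proj1 one one = one := by
  have h := proj1_smul_one hone 1
  rwa [one_smul] at h

/-- π₁ is idempotent. [folklore] -/
theorem proj1_idem {one : E} (hone : one ≠ 0) (x : E) : proj1 one (proj1 one x) = proj1 one x := by
  rw [proj1_apply one x, proj1_smul_one hone]

/-- π₁ is symmetric. [folklore] -/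
theorem proj1_symm (one x y : E) : inner ℝ (proj1 one x) y = inner ℝ x (proj1 one y) := by
  rw [proj1_apply, proj1_apply, real_inner_smul_left, real_inner_smul_right, real_inner_comm one x]
  ring

/-- Adjointness read from the other side: ⟨Q*φ, x⟩ = ⟨φ, Qx⟩. [folklore] -/
theorem adj_symm {q : E →ₗ[ℝ] F} {qs : F →ₗ[ℝ] E} (hadj : ∀ (x : E) (φ : F), inner ℝ (q x) φ = inner ℝ x (qs φ))
    (φ : F) (x : E) : inner ℝ (qs φ) x = inner ℝ φ (q x) := by
  rw [real_inner_comm x (qs φ), ← hadj, real_inner_comm φ (q x)]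

/-! ### The printed inputs as hypothesis bundles -/

/-- p. 22 [PDF 6]: "the Laplace operator Δ on the torus T_η … is a symmetric, non-negative operator, and 0 is its
eigenvalue. Constant functions form the eigenspace corresponding to the eigenvalue 0, and on the subspace orthogonal
to constant functions the operator Δ is positive. Hence it is an invertible operator and by Δ⁻¹ we denote its inverse
on this subspace. We extend it to the whole space by linearity, putting its value on constant functions equal to 0."
Typed: `Δ` symmetric, Δ1 = 0, `Δi` = Δ⁻¹ with ΔΔ⁻¹ = Δ⁻¹Δ = I − π₁ and Δ⁻¹1 = 0 (positivity is not used below and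
not recorded). [cite: Balaban1984PropagatorsI, p.22] -/
structure LapData (one : E) (Δ Δi : E →ₗ[ℝ] E) : Prop where
  symm : ∀ x y : E, inner ℝ (Δ x) y = inner ℝ x (Δ y)
  map_one : Δ one = 0
  lap_inv : ∀ x : E, Δ (Δi x) = x - proj1 one x
  inv_lap : ∀ x : E, Δi (Δ x) = x - proj1 one x
  inv_one : Δi one = 0

/-- p. 20 (1.20) "(Q′_kλ)(y) = Σ_{x∈B^k(y)} η^dλ(x)" (η = L^{−k}, so Q′_k1 = 1) and p. 22 [PDF 6]: "the operator Q′_k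
transforms constant functions on the η-lattice into constant functions on the unit lattice, and similarly for the
orthogonal subspaces. This implies the corresponding property for Q′_k*".  Typed: `qs` = Q′_k* is the adjoint of
`q` = Q′_k, Q′_k1 = 1, and Q′_k maps 1^⊥ into 1^⊥. [cite: Balaban1984PropagatorsI, (1.20) p.20, p.22] -/
structure AvgData (one : E) (one' : F) (q : E →ₗ[ℝ] F) (qs : F →ₗ[ℝ] E) : Prop where
  adj : ∀ (x : E) (φ : F), inner ℝ (q x) φ = inner ℝ x (qs φ)
  map_one : q one = one'
  perp : ∀ x : E, inner ℝ one x = 0 → inner ℝ one' (q x) = 0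

/-- p. 25 [PDF 9]: "let us denote Δ′_a = Δ + aQ′_k*Q′_k … its inverse is a bounded operator G′_k" and "Now all the
operators appearing in these formulas are well defined. We have to verify it only for (Q′_kG′_k²Q′_k*)⁻¹. It is
enough to prove that Q′_kG′_k²Q′_k* is positive definite. … We have bounds 0 < Q′_kG′_k²Q′_k* ≤ a⁻², and they imply
the existence of the inverse operator".  Typed: `g` = G′_k is the two-sided inverse of Δ′_a = Δ + aQ′_k*Q′_k and `c₂` =
(Q′_kG′_k²Q′_k*)⁻¹ the two-sided inverse of Q′_kG′_k²Q′_k* (existence, positivity and the bounds are the paper's —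
G-B5-13 — and are not re-proved here). [cite: Balaban1984PropagatorsI, p.25] -/
structure GreenData (Δ : E →ₗ[ℝ] E) (q : E →ₗ[ℝ] F) (qs : F →ₗ[ℝ] E) (a : ℝ) (g : E →ₗ[ℝ] E)
    (c₂ : F →ₗ[ℝ] F) : Prop where
  g_left : ∀ x : E, g (Δ x + a • qs (q x)) = x
  g_right : ∀ x : E, Δ (g x) + a • qs (q (g x)) = x
  c_left : ∀ φ : F, c₂ (q (g (g (qs φ)))) = φ
  c_right : ∀ φ : F, q (g (g (qs (c₂ φ)))) = φ

namespace LapData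

variable {one : E} {Δ Δi : E →ₗ[ℝ] E}

/-- Ran Δ⁻¹ ⊆ 1^⊥ in projector form: π₁Δ⁻¹ = 0 (a consequence of the p. 22 convention). [folklore] -/
theorem proj1_inv (h : LapData one Δ Δi) (x : E) : proj1 one (Δi x) = 0 := by
  have h1 := h.inv_lap (Δi x)
  rw [h.lap_inv x, map_sub] at h1
  rw [proj1_apply one x, map_smul, h.inv_one, smul_zero, sub_zero] at h1
  exact sub_eq_self.mp h1.symm

/-- Ran Δ⁻¹ ⊥ 1 (p. 22 convention). [folklore] -/
theorem inner_one_inv (h : LapData one Δ Δi) (hone : one ≠ 0) (x : E) : inner ℝ one (Δi x) = 0 :=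
  inner_eq_zero_of_proj1_eq_zero hone _ (h.proj1_inv x)

/-- ⟨1, Δλ⟩ = 0: the range of Δ is orthogonal to the constants. [folklore] -/
theorem inner_one_lap (h : LapData one Δ Δi) (x : E) : inner ℝ one (Δ x) = 0 := by
  rw [← h.symm, h.map_one, inner_zero_left]

/-- Δ⁻¹ is symmetric (p. 22: the inverse of a symmetric operator on 1^⊥, 0 on constants). [folklore] -/
theorem inv_symm (h : LapData one Δ Δi) (x y : E) :
    inner ℝ (Δi x) y = inner ℝ x (Δi y) := by
  have hy : y = Δ (Δi y) + proj1 one y := by rw [h.lap_inv, sub_add_cancel]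
  calc inner ℝ (Δi x) y = inner ℝ (Δi x) (Δ (Δi y) + proj1 one y) := by rw [← hy]
    _ = inner ℝ (Δ (Δi x)) (Δi y) + inner ℝ (Δi x) (proj1 one y) := by rw [inner_add_right, ← h.symm]
    _ = inner ℝ (x - proj1 one x) (Δi y) + 0 := by
        rw [h.lap_inv, ← proj1_symm, h.proj1_inv x, inner_zero_left]
    _ = inner ℝ x (Δi y) := by
        rw [add_zero, inner_sub_left, proj1_symm, h.proj1_inv y, inner_zero_right, sub_zero]

end LapData

namespace AvgData

variable {one : E} {one' : F} {q : E →ₗ[ℝ] F} {qs : F →ₗ[ℝ] E}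

/-- ⟨1, Q′_k*φ⟩ = ⟨Q′_k1, φ⟩ = ⟨1, φ⟩ (uses Q′_k1 = 1, (1.20)). [folklore] -/
theorem inner_one_qs (h : AvgData one one' q qs) (φ : F) : inner ℝ one (qs φ) = inner ℝ one' φ := by
  rw [← h.adj, h.map_one]

/-- N(Q′_k) ⊆ 1^⊥ — fact (F1) of GAPS C-adv4-33 ("Q′_kλ = 0 ⇒ Σ_xλ(x) = 0"), here from p. 22's "similarly for the
orthogonal subspaces" and Q′_k1 = 1 ≠ 0. [folklore] -/
theorem inner_one_of_ker (h : AvgData one one' q qs) (hone : one ≠ 0) (hone' : one' ≠ 0) (l : E)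
    (hl : q l = 0) : inner ℝ one l = 0 := by
  have hsplit : l = (l - proj1 one l) + proj1 one l := (sub_add_cancel l _).symm
  have h1 : inner ℝ one' (q (l - proj1 one l)) = 0 := h.perp _ (inner_one_sub_proj1 hone l)
  have h2 : q l = q (l - proj1 one l) + (inner ℝ one l / inner ℝ one one) • one' := by
    conv_lhs => rw [hsplit]
    rw [map_add, proj1_apply, map_smul, h.map_one]
  rw [hl] at h2
  have h3 : inner ℝ one' (q (l - proj1 one l) + (inner ℝ one l / inner ℝ one one) • one') = 0 := by
    rw [← h2, inner_zero_right]
  rw [inner_add_right, h1, zero_add, real_inner_smul_right] at h3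
  rcases mul_eq_zero.mp h3 with h4 | h4
  · rcases div_eq_zero_iff.mp h4 with h5 | h5
    · exact h5
    · exact absurd h5 (inner_self_ne_zero.mpr hone)
  · exact absurd h4 (inner_self_ne_zero.mpr hone')

end AvgData

namespace GreenData

variable {Δ : E →ₗ[ℝ] E} {q : E →ₗ[ℝ] F} {qs : F →ₗ[ℝ] E} {a : ℝ} {g : E →ₗ[ℝ] E} {c₂ : F →ₗ[ℝ] F}

/-- G′_k is symmetric (inverse of the symmetric Δ′_a). [folklore] -/
theorem symm (hG : GreenData Δ q qs a g c₂) (hΔ : ∀ x y : E, inner ℝ (Δ x) y = inner ℝ x (Δ y))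
    (hadj : ∀ (x : E) (φ : F), inner ℝ (q x) φ = inner ℝ x (qs φ)) (x y : E) :
    inner ℝ (g x) y = inner ℝ x (g y) := by
  calc inner ℝ (g x) y = inner ℝ (g x) (Δ (g y) + a • qs (q (g y))) := by rw [hG.g_right]
    _ = inner ℝ (Δ (g x)) (g y) + a * inner ℝ (q (g x)) (q (g y)) := by
        rw [inner_add_right, ← hΔ, real_inner_smul_right, ← hadj]
    _ = inner ℝ (Δ (g x) + a • qs (q (g x))) (g y) := by
        rw [inner_add_left, real_inner_smul_left, adj_symm hadj]
    _ = inner ℝ x (g y) := by rw [hG.g_right]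

/-- Q′_kG′_k²Q′_k* is symmetric. [folklore] -/
theorem qggqs_symm (hG : GreenData Δ q qs a g c₂) (hΔ : ∀ x y : E, inner ℝ (Δ x) y = inner ℝ x (Δ y))
    (hadj : ∀ (x : E) (φ : F), inner ℝ (q x) φ = inner ℝ x (qs φ)) (u v : F) :
    inner ℝ (q (g (g (qs u)))) v = inner ℝ u (q (g (g (qs v)))) := by
  calc inner ℝ (q (g (g (qs u)))) v = inner ℝ (g (g (qs u))) (qs v) := hadj _ _
    _ = inner ℝ (g (qs u)) (g (qs v)) := hG.symm hΔ hadj _ _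
    _ = inner ℝ (qs u) (g (g (qs v))) := hG.symm hΔ hadj _ _
    _ = inner ℝ u (q (g (g (qs v)))) := adj_symm hadj _ _

/-- (Q′_kG′_k²Q′_k*)⁻¹ is symmetric. [folklore] -/
theorem c_symm (hG : GreenData Δ q qs a g c₂) (hΔ : ∀ x y : E, inner ℝ (Δ x) y = inner ℝ x (Δ y))
    (hadj : ∀ (x : E) (φ : F), inner ℝ (q x) φ = inner ℝ x (qs φ)) (φ ψ : F) :
    inner ℝ (c₂ φ) ψ = inner ℝ φ (c₂ ψ) := by
  calc inner ℝ (c₂ φ) ψ = inner ℝ (c₂ φ) (q (g (g (qs (c₂ ψ))))) := by rw [hG.c_right]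
    _ = inner ℝ (q (g (g (qs (c₂ φ))))) (c₂ ψ) := by rw [hG.qggqs_symm hΔ hadj]
    _ = inner ℝ φ (c₂ ψ) := by rw [hG.c_right]

/-- On N(Q′_k) the operators Δ′_a and Δ agree: G′_kΔλ = λ if Q′_kλ = 0. [folklore] -/
theorem g_lap (hG : GreenData Δ q qs a g c₂) (l : E) (hl : q l = 0) : g (Δ l) = l := by
  have h := hG.g_left l
  rwa [hl, map_zero, smul_zero, add_zero] at h

/-- ΔG′_kω = ω when Q′_kG′_kω = 0. [folklore] -/
theorem lap_g (hG : GreenData Δ q qs a g c₂) (ω : E) (hω : q (g ω) = 0) : Δ (g ω) = ω := by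
  have h := hG.g_right ω
  rwa [hω, map_zero, smul_zero, add_zero] at h

/-- aG′_kQ′_k*1 = 1 (from Δ′_a1 = aQ′_k*Q′_k1 = aQ′_k*1). [folklore] -/
theorem smul_g_qs_one' {one : E} {one' : F} {Δi : E →ₗ[ℝ] E} (hG : GreenData Δ q qs a g c₂)
    (hΔ : LapData one Δ Δi) (hQ : AvgData one one' q qs) : a • g (qs one') = one := by
  have h := hG.g_left one
  rwa [hΔ.map_one, zero_add, hQ.map_one, map_smul] at h

/-- The hypotheses force a ≠ 0 (print: "with a > 0"). [folklore] -/
theorem a_ne_zero {one : E} {one' : F} {Δi : E →ₗ[ℝ] E} (hG : GreenData Δ q qs a g c₂)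
    (hΔ : LapData one Δ Δi) (hQ : AvgData one one' q qs) (hone : one ≠ 0) : a ≠ 0 := by
  intro ha
  have h := hG.smul_g_qs_one' hΔ hQ
  rw [ha, zero_smul] at h
  exact hone h.symm

end GreenData

/-! ### The operator (1.38) -/

section R138

variable (Δi : E →ₗ[ℝ] E) (q : E →ₗ[ℝ] F) (qs : F →ₗ[ℝ] E) (ci : F →ₗ[ℝ] F)

/-- I − R of **(1.38)** p. 24 [PDF 8]: the operator Δ⁻¹Q′_k*(Q′_kΔ⁻²Q′_k*)⁻¹Q′_kΔ⁻¹ (`Δi` = Δ⁻¹, `q` = Q′_k,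
`qs` = Q′_k*, `ci` = (Q′_kΔ⁻²Q′_k*)⁻¹), "the projection operator acting on ∂*A and appearing in (1.27)".
[cite: Balaban1984PropagatorsI, (1.38) p.24] -/
def P138 : E →ₗ[ℝ] E := Δi ∘ₗ qs ∘ₗ ci ∘ₗ q ∘ₗ Δi

/-- **(1.38)** p. 24 [PDF 8]: "R = I − Δ⁻¹Q′_k*(Q′_kΔ⁻²Q′_k*)⁻¹Q′_kΔ⁻¹" (opening parenthesis restored, G-B5-14 (i)).
[cite: Balaban1984PropagatorsI, (1.38) p.24] -/
def R138 : E →ₗ[ℝ] E := LinearMap.id - P138 Δi q qs ci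

/-- Unfolding of `P138`. [folklore] -/
theorem P138_apply (x : E) : P138 Δi q qs ci x = Δi (qs (ci (q (Δi x)))) := rfl

/-- Unfolding of `R138` = I − `P138`. [folklore] -/
theorem R138_apply (x : E) : R138 Δi q qs ci x = x - P138 Δi q qs ci x := rfl

variable {Δi q qs ci} {one : E} {one' : F} {Δ : E →ₗ[ℝ] E}

/-- (1.38) does not depend on WHICH right inverse of Q′_kΔ⁻²Q′_k* on 1^⊥ is taken for (Q′_kΔ⁻²Q′_k*)⁻¹ (the printed
one is the inverse on that subspace, p. 22). [folklore] -/
theorem P138_eq_of_rightInv {ci' : F →ₗ[ℝ] F} (hΔ : LapData one Δ Δi) (hQ : AvgData one one' q qs)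
    (hone : one ≠ 0)
    (hci : ∀ φ : F, inner ℝ one' φ = 0 → q (Δi (Δi (qs (ci φ)))) = φ)
    (hci' : ∀ φ : F, inner ℝ one' φ = 0 → q (Δi (Δi (qs (ci' φ)))) = φ) (x : E) :
    P138 Δi q qs ci x = P138 Δi q qs ci' x := by
  have hφ : inner ℝ one' (q (Δi x)) = 0 := hQ.perp _ (hΔ.inner_one_inv hone x)
  set u : F := ci (q (Δi x)) - ci' (q (Δi x)) with hu
  have hMu : q (Δi (Δi (qs u))) = 0 := by
    rw [hu, map_sub, map_sub, map_sub, map_sub, hci _ hφ, hci' _ hφ, sub_self]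
  have h0 : inner ℝ (Δi (qs u)) (Δi (qs u)) = 0 := by
    rw [← hΔ.inv_symm, ← hQ.adj, hMu, inner_zero_left]
  have h1 : Δi (qs u) = 0 := inner_self_eq_zero.mp h0
  rw [hu, map_sub, map_sub, sub_eq_zero] at h1
  rw [P138_apply, P138_apply, h1]

/-- p. 25 l. 3: "Indeed RΔλ = Δλ if Q′_kλ = 0" ✓ for (1.38). [cite: Balaban1984PropagatorsI, p.25 l.3] -/
theorem R138_lap (hΔ : LapData one Δ Δi) (hQ : AvgData one one' q qs) (hone : one ≠ 0) (hone' : one' ≠ 0)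
    (l : E) (hl : q l = 0) : R138 Δi q qs ci (Δ l) = Δ l := by
  have h1 : Δi (Δ l) = l := by
    rw [hΔ.inv_lap, proj1_eq_zero_of_inner _ _ (hQ.inner_one_of_ker hone hone' l hl), sub_zero]
  rw [R138_apply, P138_apply, h1, hl, map_zero, map_zero, map_zero, sub_zero]

/-- G-adv4-11 (ii): with the p. 22 convention Δ⁻¹1 = 0 the operator (1.38) FIXES the constants, R1 = 1.
[folklore] -/
theorem R138_one (hΔ : LapData one Δ Δi) : R138 Δi q qs ci one = one := by
  rw [R138_apply, P138_apply, hΔ.inv_one, map_zero, map_zero, map_zero, map_zero, sub_zero]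

/-- 1 is never of the form Δλ (⟨1, Δλ⟩ = 0 and 1 ≠ 0). [folklore] -/
theorem one_ne_lap (hΔ : LapData one Δ Δi) (hone : one ≠ 0) (l : E) : one ≠ Δ l := by
  intro h
  have h0 : inner ℝ one one = 0 := by
    calc inner ℝ one one = inner ℝ one (Δ l) := by rw [← h]
      _ = 0 := hΔ.inner_one_lap l
  exact hone (inner_self_eq_zero.mp h0)

/-- THE PRINTED CLAUSE FAILS FOR (1.38) (G-adv4-11 (ii)): p. 25 ll. 4–5 "if Rω = ω then … taking λ = Δ⁻¹ω we have
ω = Δλ and Q′_kλ = 0" — ω = 1 is a fixed vector of (1.38) which is not of the form Δλ with Q′_kλ = 0.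
[cite: Balaban1984PropagatorsI, p.25 ll.4-5 (refuted as printed for (1.38))] -/
theorem printed_clause_fails (hΔ : LapData one Δ Δi) (hone : one ≠ 0) :
    R138 Δi q qs ci one = one ∧ ¬ ∃ l : E, q l = 0 ∧ one = Δ l :=
  ⟨R138_one hΔ, fun ⟨l, _, h⟩ => one_ne_lap hΔ hone l h⟩

/-- G-adv4-11 (i): Rω = ω ⟺ Q′_kΔ⁻¹ω = 0 for (1.38) — the printed factor Δ₀ in "Δ₀Q′_kΔ⁻¹ω = 0" is idle.
(`hci`: (Q′_kΔ⁻²Q′_k*)⁻¹ is a right inverse of Q′_kΔ⁻²Q′_k* on 1^⊥(T₁^{(k)}), p. 22.) [folklore] -/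
theorem R138_fix_iff (hΔ : LapData one Δ Δi) (hQ : AvgData one one' q qs) (hone : one ≠ 0)
    (hci : ∀ φ : F, inner ℝ one' φ = 0 → q (Δi (Δi (qs (ci φ)))) = φ) (ω : E) :
    R138 Δi q qs ci ω = ω ↔ q (Δi ω) = 0 := by
  rw [R138_apply, sub_eq_self, P138_apply]
  constructor
  · intro h0
    have h1 := hci (q (Δi ω)) (hQ.perp _ (hΔ.inner_one_inv hone ω))
    rw [h0, map_zero, map_zero] at h1
    exact h1.symm
  · intro h0
    rw [h0, map_zero, map_zero, map_zero]

/-- The printed form of (i) is equivalent: for ANY operator Δ₀ on T₁^{(k)} injective on 1^⊥ (the unit-lattice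
Laplacian of p. 24 is), Rω = ω ⟺ Δ₀Q′_kΔ⁻¹ω = 0. [cite: Balaban1984PropagatorsI, p.25 l.4] -/
theorem R138_fix_iff_unitLap {Δ₀ : F →ₗ[ℝ] F} (hΔ : LapData one Δ Δi) (hQ : AvgData one one' q qs)
    (hone : one ≠ 0) (hci : ∀ φ : F, inner ℝ one' φ = 0 → q (Δi (Δi (qs (ci φ)))) = φ)
    (hΔ₀ : ∀ φ : F, inner ℝ one' φ = 0 → Δ₀ φ = 0 → φ = 0) (ω : E) :
    R138 Δi q qs ci ω = ω ↔ Δ₀ (q (Δi ω)) = 0 := by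
  rw [R138_fix_iff hΔ hQ hone hci]
  constructor
  · intro h0
    rw [h0, map_zero]
  · intro h0
    exact hΔ₀ _ (hQ.perp _ (hΔ.inner_one_inv hone ω)) h0

/-- Fixed space of (1.38) = ΔN(Q′_k) ⊕ ℝ·1 (G-adv4-11 (ii); C-B5-8 "projects onto ΔN(Q′_k) ⊕ ℝ·1").
[folklore] -/
theorem R138_fix_iff_exists (hΔ : LapData one Δ Δi) (hQ : AvgData one one' q qs) (hone : one ≠ 0)
    (hone' : one' ≠ 0) (hci : ∀ φ : F, inner ℝ one' φ = 0 → q (Δi (Δi (qs (ci φ)))) = φ) (ω : E) :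
    R138 Δi q qs ci ω = ω ↔ ∃ l : E, ∃ t : ℝ, q l = 0 ∧ ω = Δ l + t • one := by
  rw [R138_fix_iff hΔ hQ hone hci]
  constructor
  · intro h0
    refine ⟨Δi ω, inner ℝ one ω / inner ℝ one one, h0, ?_⟩
    rw [hΔ.lap_inv, ← proj1_apply, sub_add_cancel]
  · rintro ⟨l, t, hl, rfl⟩
    rw [map_add, map_smul, hΔ.inv_one, smul_zero, add_zero, hΔ.inv_lap,
      proj1_eq_zero_of_inner _ _ (hQ.inner_one_of_ker hone hone' l hl), sub_zero, hl]

/-- THE REPAIRED SENTENCE (G-adv4-11 repair "if Rω = ω and ω ⊥ 1 then …"): for ω ⊥ 1, Rω = ω ⟺ ω = Δλ with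
Q′_kλ = 0. [cite: Balaban1984PropagatorsI, p.25 ll.4-5 (repaired)] -/
theorem R138_fix_iff_of_orth (hΔ : LapData one Δ Δi) (hQ : AvgData one one' q qs) (hone : one ≠ 0)
    (hone' : one' ≠ 0) (hci : ∀ φ : F, inner ℝ one' φ = 0 → q (Δi (Δi (qs (ci φ)))) = φ) (ω : E)
    (hω : inner ℝ one ω = 0) :
    R138 Δi q qs ci ω = ω ↔ ∃ l : E, q l = 0 ∧ ω = Δ l := by
  rw [R138_fix_iff hΔ hQ hone hci]
  constructor
  · intro h0
    exact ⟨Δi ω, h0, by rw [hΔ.lap_inv, proj1_eq_zero_of_inner _ _ hω, sub_zero]⟩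
  · rintro ⟨l, hl, rfl⟩
    rw [hΔ.inv_lap, proj1_eq_zero_of_inner _ _ (hQ.inner_one_of_ker hone hone' l hl), sub_zero, hl]

/-- I − R of (1.38) is idempotent. [folklore] -/
theorem P138_idem (hΔ : LapData one Δ Δi) (hQ : AvgData one one' q qs) (hone : one ≠ 0)
    (hci : ∀ φ : F, inner ℝ one' φ = 0 → q (Δi (Δi (qs (ci φ)))) = φ) (ω : E) :
    P138 Δi q qs ci (P138 Δi q qs ci ω) = P138 Δi q qs ci ω := by
  rw [P138_apply, P138_apply, hci _ (hQ.perp _ (hΔ.inner_one_inv hone ω))]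

/-- I − R of (1.38) is symmetric (needs only that (Q′_kΔ⁻²Q′_k*)⁻¹ is a right inverse on 1^⊥: the symmetry of
(Q′_kΔ⁻²Q′_k*)⁻¹ on that subspace follows). [folklore] -/
theorem P138_symm (hΔ : LapData one Δ Δi) (hQ : AvgData one one' q qs) (hone : one ≠ 0)
    (hci : ∀ φ : F, inner ℝ one' φ = 0 → q (Δi (Δi (qs (ci φ)))) = φ) (x y : E) :
    inner ℝ (P138 Δi q qs ci x) y = inner ℝ x (P138 Δi q qs ci y) := by
  have hM : ∀ u v : F, inner ℝ (q (Δi (Δi (qs u)))) v = inner ℝ u (q (Δi (Δi (qs v)))) := by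
    intro u v
    calc inner ℝ (q (Δi (Δi (qs u)))) v = inner ℝ (Δi (Δi (qs u))) (qs v) := hQ.adj _ _
      _ = inner ℝ (Δi (qs u)) (Δi (qs v)) := hΔ.inv_symm _ _
      _ = inner ℝ (qs u) (Δi (Δi (qs v))) := hΔ.inv_symm _ _
      _ = inner ℝ u (q (Δi (Δi (qs v)))) := adj_symm hQ.adj _ _
  have hc : ∀ u v : F, inner ℝ one' u = 0 → inner ℝ one' v = 0 →
      inner ℝ (ci u) v = inner ℝ u (ci v) := by
    intro u v hu hv
    calc inner ℝ (ci u) v = inner ℝ (ci u) (q (Δi (Δi (qs (ci v))))) := by rw [hci v hv]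
      _ = inner ℝ (q (Δi (Δi (qs (ci u))))) (ci v) := by rw [hM]
      _ = inner ℝ u (ci v) := by rw [hci u hu]
  have hx : inner ℝ one' (q (Δi x)) = 0 := hQ.perp _ (hΔ.inner_one_inv hone x)
  have hy : inner ℝ one' (q (Δi y)) = 0 := hQ.perp _ (hΔ.inner_one_inv hone y)
  calc inner ℝ (P138 Δi q qs ci x) y = inner ℝ (qs (ci (q (Δi x)))) (Δi y) := by
        rw [P138_apply, hΔ.inv_symm]
    _ = inner ℝ (ci (q (Δi x))) (q (Δi y)) := adj_symm hQ.adj _ _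
    _ = inner ℝ (q (Δi x)) (ci (q (Δi y))) := hc _ _ hx hy
    _ = inner ℝ (Δi x) (qs (ci (q (Δi y)))) := hQ.adj _ _
    _ = inner ℝ x (P138 Δi q qs ci y) := by rw [P138_apply, ← hΔ.inv_symm]

/-- p. 22: "the operator I − Δ⁻¹Q′_k*(Q′_kΔ⁻²Q′_k*)⁻¹Q′_kΔ⁻¹ is a projection" — (1.38) is idempotent.
[cite: Balaban1984PropagatorsI, p.22] -/
theorem R138_idem (hΔ : LapData one Δ Δi) (hQ : AvgData one one' q qs) (hone : one ≠ 0)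
    (hci : ∀ φ : F, inner ℝ one' φ = 0 → q (Δi (Δi (qs (ci φ)))) = φ) (ω : E) :
    R138 Δi q qs ci (R138 Δi q qs ci ω) = R138 Δi q qs ci ω := by
  rw [R138_apply (x := R138 Δi q qs ci ω), R138_apply, map_sub, P138_idem hΔ hQ hone hci ω, sub_self,
    sub_zero]

/-- … and symmetric: an orthogonal projection (p. 25 "It is an orthogonal projection"). [folklore] -/
theorem R138_symm (hΔ : LapData one Δ Δi) (hQ : AvgData one one' q qs) (hone : one ≠ 0)
    (hci : ∀ φ : F, inner ℝ one' φ = 0 → q (Δi (Δi (qs (ci φ)))) = φ) (x y : E) :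
    inner ℝ (R138 Δi q qs ci x) y = inner ℝ x (R138 Δi q qs ci y) := by
  rw [R138_apply, R138_apply, inner_sub_left, inner_sub_right, P138_symm hΔ hQ hone hci]

/-- R₍₁.₃₈₎π₁ = π₁ (R fixes constants). [folklore] -/
theorem R138_proj1 (hΔ : LapData one Δ Δi) (x : E) :
    R138 Δi q qs ci (proj1 one x) = proj1 one x := by
  rw [proj1_apply, map_smul, R138_one hΔ]

/-- π₁R₍₁.₃₈₎ = π₁ (Ran (I − R) ⊥ 1). [folklore] -/
theorem proj1_R138 (hΔ : LapData one Δ Δi) (x : E) :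
    proj1 one (R138 Δi q qs ci x) = proj1 one x := by
  rw [R138_apply, map_sub, P138_apply, hΔ.proj1_inv, sub_zero]

end R138

/-! ### The operator (1.44) and the minimiser (1.43) -/

section R144

variable (Δ : E →ₗ[ℝ] E) (q : E →ₗ[ℝ] F) (qs : F →ₗ[ℝ] E) (a : ℝ) (g : E →ₗ[ℝ] E) (c₂ : F →ₗ[ℝ] F)

/-- Δ′_a = Δ + aQ′_k*Q′_k of p. 25 [PDF 9]. [cite: Balaban1984PropagatorsI, p.25] -/
def lapPrime : E →ₗ[ℝ] E := Δ + a • (qs ∘ₗ q)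

/-- Unfolding of `lapPrime`: Δ′_ax = Δx + aQ′_k*Q′_kx. [folklore] -/
theorem lapPrime_apply (x : E) : lapPrime Δ q qs a x = Δ x + a • qs (q x) := rfl

/-- I − R of **(1.44)** p. 25 [PDF 9]: P_a = G′_kQ′_k*(Q′_kG′_k²Q′_k*)⁻¹Q′_kG′_k (`g` = G′_k, `c₂` = (Q′_kG′_k²Q′_k*)⁻¹).
[cite: Balaban1984PropagatorsI, (1.44) p.25] -/
def P144 : E →ₗ[ℝ] E := g ∘ₗ qs ∘ₗ c₂ ∘ₗ q ∘ₗ g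

/-- **(1.44)** p. 25 [PDF 9]: "R = I − G′_kQ′_k*(Q′_kG′_k²Q′_k*)⁻¹Q′_kG′_k". [cite: Balaban1984PropagatorsI, (1.44) p.25] -/
def R144 : E →ₗ[ℝ] E := LinearMap.id - P144 q qs g c₂

/-- **(1.43)** p. 25 [PDF 9], as a linear map of ∂*A: "λ₀ = G′_k∂*A − G′_k²Q′_k*(Q′_kG′_k²Q′_k*)⁻¹Q′_kG′_k∂*A".
[cite: Balaban1984PropagatorsI, (1.43) p.25] -/
def lambda0 : E →ₗ[ℝ] E := g - g ∘ₗ g ∘ₗ qs ∘ₗ c₂ ∘ₗ q ∘ₗ g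

/-- Unfolding of `P144`. [folklore] -/
theorem P144_apply (x : E) : P144 q qs g c₂ x = g (qs (c₂ (q (g x)))) := rfl

/-- Unfolding of `R144` = I − `P144`. [folklore] -/
theorem R144_apply (x : E) : R144 q qs g c₂ x = x - P144 q qs g c₂ x := rfl

/-- Unfolding of `lambda0`, literally (1.43). [folklore] -/
theorem lambda0_apply (f : E) : lambda0 q qs g c₂ f = g f - g (g (qs (c₂ (q (g f))))) := rfl

/-- λ₀ = G′_kR∂*A (regrouping of (1.43) by (1.44)). [folklore] -/
theorem lambda0_eq_g_R144 (f : E) : lambda0 q qs g c₂ f = g (R144 q qs g c₂ f) := by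
  rw [lambda0_apply, R144_apply, P144_apply, map_sub]

variable {Δ q qs a g c₂} {one : E} {one' : F} {Δi : E →ₗ[ℝ] E}

/-- For (1.44): Rω = ω ⟺ Q′_kG′_kω = 0. [folklore] -/
theorem R144_fix_iff (hG : GreenData Δ q qs a g c₂) (ω : E) :
    R144 q qs g c₂ ω = ω ↔ q (g ω) = 0 := by
  rw [R144_apply, sub_eq_self, P144_apply]
  constructor
  · intro h0
    have h1 := hG.c_right (q (g ω))
    rw [h0, map_zero, map_zero] at h1
    exact h1.symm
  · intro h0
    rw [h0, map_zero, map_zero, map_zero]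

/-- p. 25 "R = ΔN(Q′_k)" is literally true for (1.44), for every a: {ω : Rω = ω} = {Δλ : Q′_kλ = 0}.
[cite: Balaban1984PropagatorsI, p.25 ll.2-5 (for (1.44))] -/
theorem R144_fix_iff_exists (hG : GreenData Δ q qs a g c₂) (ω : E) :
    R144 q qs g c₂ ω = ω ↔ ∃ l : E, q l = 0 ∧ ω = Δ l := by
  rw [R144_fix_iff hG]
  constructor
  · intro h0
    exact ⟨g ω, h0, (hG.lap_g ω h0).symm⟩
  · rintro ⟨l, hl, rfl⟩
    rw [hG.g_lap l hl, hl]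

/-- "RΔλ = Δλ if Q′_kλ = 0" for (1.44). [folklore] -/
theorem R144_lap (hG : GreenData Δ q qs a g c₂) (l : E) (hl : q l = 0) :
    R144 q qs g c₂ (Δ l) = Δ l :=
  (R144_fix_iff_exists hG _).mpr ⟨l, hl, rfl⟩

/-- (I − R)G′_kQ′_k* = G′_kQ′_k* (Ran G′_kQ′_k* ⊆ Ran (I − R)). [folklore] -/
theorem P144_g_qs (hG : GreenData Δ q qs a g c₂) (ψ : F) :
    P144 q qs g c₂ (g (qs ψ)) = g (qs ψ) := by
  rw [P144_apply, hG.c_left]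

/-- P_a1 = 1: the operator (1.44) KILLS the constants (contrast `R138_one`). [folklore] -/
theorem P144_one (hG : GreenData Δ q qs a g c₂) (hΔ : LapData one Δ Δi) (hQ : AvgData one one' q qs) :
    P144 q qs g c₂ one = one := by
  have h := hG.smul_g_qs_one' hΔ hQ
  calc P144 q qs g c₂ one = P144 q qs g c₂ (a • g (qs one')) := by rw [h]
    _ = a • P144 q qs g c₂ (g (qs one')) := map_smul _ _ _
    _ = a • g (qs one') := by rw [P144_g_qs hG]
    _ = one := h

/-- R1 = 0 for (1.44). [folklore] -/
theorem R144_one (hG : GreenData Δ q qs a g c₂) (hΔ : LapData one Δ Δi) (hQ : AvgData one one' q qs) :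
    R144 q qs g c₂ one = 0 := by
  rw [R144_apply, P144_one hG hΔ hQ, sub_self]

/-- I − R of (1.44) is idempotent. [folklore] -/
theorem P144_idem (hG : GreenData Δ q qs a g c₂) (ω : E) :
    P144 q qs g c₂ (P144 q qs g c₂ ω) = P144 q qs g c₂ ω := by
  rw [P144_apply, P144_apply, hG.c_right]

/-- I − R of (1.44) is symmetric. [folklore] -/
theorem P144_symm (hG : GreenData Δ q qs a g c₂) (hΔ : ∀ x y : E, inner ℝ (Δ x) y = inner ℝ x (Δ y))
    (hadj : ∀ (x : E) (φ : F), inner ℝ (q x) φ = inner ℝ x (qs φ)) (x y : E) :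
    inner ℝ (P144 q qs g c₂ x) y = inner ℝ x (P144 q qs g c₂ y) := by
  calc inner ℝ (P144 q qs g c₂ x) y = inner ℝ (qs (c₂ (q (g x)))) (g y) := by
        rw [P144_apply, hG.symm hΔ hadj]
    _ = inner ℝ (c₂ (q (g x))) (q (g y)) := adj_symm hadj _ _
    _ = inner ℝ (q (g x)) (c₂ (q (g y))) := hG.c_symm hΔ hadj _ _
    _ = inner ℝ (g x) (qs (c₂ (q (g y)))) := hadj _ _
    _ = inner ℝ x (P144 q qs g c₂ y) := by rw [P144_apply, ← hG.symm hΔ hadj]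

/-- (1.44) is idempotent … [folklore] -/
theorem R144_idem (hG : GreenData Δ q qs a g c₂) (ω : E) :
    R144 q qs g c₂ (R144 q qs g c₂ ω) = R144 q qs g c₂ ω := by
  rw [R144_apply (x := R144 q qs g c₂ ω), R144_apply, map_sub, P144_idem hG ω, sub_self, sub_zero]

/-- … and symmetric: an orthogonal projection, onto ΔN(Q′_k) (`R144_fix_iff_exists`). [folklore] -/
theorem R144_symm (hG : GreenData Δ q qs a g c₂) (hΔ : ∀ x y : E, inner ℝ (Δ x) y = inner ℝ x (Δ y))
    (hadj : ∀ (x : E) (φ : F), inner ℝ (q x) φ = inner ℝ x (qs φ)) (x y : E) :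
    inner ℝ (R144 q qs g c₂ x) y = inner ℝ x (R144 q qs g c₂ y) := by
  rw [R144_apply, R144_apply, inner_sub_left, inner_sub_right, P144_symm hG hΔ hadj]

/-- An orthogonal projection is determined by its fixed vectors: two symmetric idempotents with the same fixed
space are equal. [folklore] -/
theorem eq_of_symm_idem_fix {P P' : E →ₗ[ℝ] E} (hP : ∀ x, P (P x) = P x) (hP' : ∀ x, P' (P' x) = P' x)
    (sP : ∀ x y, inner ℝ (P x) y = inner ℝ x (P y)) (sP' : ∀ x y, inner ℝ (P' x) y = inner ℝ x (P' y))
    (hfix : ∀ x, P x = x ↔ P' x = x) : P = P' := by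
  ext x
  apply ext_inner_right ℝ
  intro y
  have h1 : P' (P x) = P x := (hfix (P x)).mp (hP x)
  have h2 : P (P' y) = P' y := (hfix (P' y)).mpr (hP' y)
  calc inner ℝ (P x) y = inner ℝ (P' (P x)) y := by rw [h1]
    _ = inner ℝ (P x) (P' y) := sP' _ _
    _ = inner ℝ x (P (P' y)) := sP _ _
    _ = inner ℝ x (P' y) := by rw [h2]
    _ = inner ℝ (P' x) y := (sP' x y).symm

/-- p. 26 [PDF 10] (text after (1.45)) ll. 5–7: "The operator R given by (1.44) is of course by definition independent of a" —
PROVED: any two systems (a, G′_k, (Q′_kG′_k²Q′_k*)⁻¹), (a′, G′, c′) over the same Δ, Q′_k give the same (1.44).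
[cite: Balaban1984PropagatorsI, p.26 ll.5-7] -/
theorem R144_indep {a' : ℝ} {g' : E →ₗ[ℝ] E} {c₂' : F →ₗ[ℝ] F} (hG : GreenData Δ q qs a g c₂)
    (hG' : GreenData Δ q qs a' g' c₂') (hΔ : ∀ x y : E, inner ℝ (Δ x) y = inner ℝ x (Δ y))
    (hadj : ∀ (x : E) (φ : F), inner ℝ (q x) φ = inner ℝ x (qs φ)) :
    R144 q qs g c₂ = R144 q qs g' c₂' :=
  eq_of_symm_idem_fix (R144_idem hG) (R144_idem hG') (R144_symm hG hΔ hadj) (R144_symm hG' hΔ hadj)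
    (fun x => by rw [R144_fix_iff_exists hG, R144_fix_iff_exists hG'])

/-! #### The minimiser (1.43) and the square completion behind (1.42) ⇒ (1.43)–(1.44) -/

/-- Q′_kλ₀ = 0: the minimiser (1.43) satisfies the constraint. [folklore] -/
theorem q_lambda0 (hG : GreenData Δ q qs a g c₂) (f : E) : q (lambda0 q qs g c₂ f) = 0 := by
  rw [lambda0_eq_g_R144]
  exact (R144_fix_iff hG _).mp (R144_idem hG f)

/-- Δ′_aλ₀ = R∂*A. [folklore] -/
theorem lapPrime_lambda0 (hG : GreenData Δ q qs a g c₂) (f : E) :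
    lapPrime Δ q qs a (lambda0 q qs g c₂ f) = R144 q qs g c₂ f := by
  rw [lapPrime_apply, lambda0_eq_g_R144, hG.g_right]

/-- Δλ₀ = R∂*A (on N(Q′_k), Δ′_a = Δ). [folklore] -/
theorem lap_lambda0 (hG : GreenData Δ q qs a g c₂) (f : E) :
    Δ (lambda0 q qs g c₂ f) = R144 q qs g c₂ f := by
  have h := lapPrime_lambda0 hG f
  rwa [lapPrime_apply, q_lambda0 hG, map_zero, smul_zero, add_zero] at h

/-- ∂*A − Δ′_aλ₀ = (I − R)∂*A = G′_kQ′_k*(Q′_kG′_k²Q′_k*)⁻¹Q′_kG′_k∂*A — the computation the text summarises as "we get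
the following formulas for the minimizing function λ₀ (1.43) and for the projection operator R (1.44)".
[cite: Balaban1984PropagatorsI, (1.43)-(1.44) p.25] -/
theorem residual_143 (hG : GreenData Δ q qs a g c₂) (f : E) :
    f - lapPrime Δ q qs a (lambda0 q qs g c₂ f) = P144 q qs g c₂ f := by
  rw [lapPrime_lambda0 hG, R144_apply, sub_sub_cancel]

/-- Pythagoras for an orthogonal projection R and a fixed vector v: ‖f − v‖² = ‖Rf − v‖² + ‖f − Rf‖².
[folklore] -/
theorem norm_sq_sub_of_fix {R : E →ₗ[ℝ] E} (hR : ∀ x, R (R x) = R x)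
    (sR : ∀ x y, inner ℝ (R x) y = inner ℝ x (R y)) (f v : E) (hv : R v = v) :
    ‖f - v‖ ^ 2 = ‖R f - v‖ ^ 2 + ‖f - R f‖ ^ 2 := by
  have hsplit : f - v = (R f - v) + (f - R f) := by abel
  have horth : inner ℝ (R f - v) (f - R f) = 0 := by
    have h1 : R (R f - v) = R f - v := by rw [map_sub, hR, hv]
    rw [← h1, sR, map_sub, hR, sub_self, inner_zero_right]
  rw [hsplit, norm_add_sq_real, horth, mul_zero, add_zero]

/-- COMPLETING THE SQUARE in (1.42) (C-adv4-33 (F2) / C-adv4-34): for λ ∈ N(Q′_k),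
‖∂*A − Δλ − aQ′_k*Q′_kλ‖² = ‖Δ(λ₀ − λ)‖² + ‖(I − R)∂*A‖². [folklore] -/
theorem norm_sq_split_142 (hG : GreenData Δ q qs a g c₂) (hΔ : ∀ x y : E, inner ℝ (Δ x) y = inner ℝ x (Δ y))
    (hadj : ∀ (x : E) (φ : F), inner ℝ (q x) φ = inner ℝ x (qs φ)) (f l : E) (hl : q l = 0) :
    ‖f - lapPrime Δ q qs a l‖ ^ 2 =
      ‖Δ (lambda0 q qs g c₂ f - l)‖ ^ 2 + ‖P144 q qs g c₂ f‖ ^ 2 := by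
  have h := norm_sq_sub_of_fix (R144_idem hG) (R144_symm hG hΔ hadj) f (Δ l) (R144_lap hG l hl)
  have hP : f - R144 q qs g c₂ f = P144 q qs g c₂ f := by rw [R144_apply, sub_sub_cancel]
  rw [lapPrime_apply, hl, map_zero, smul_zero, add_zero, h, hP, ← lap_lambda0 hG f, ← map_sub]

/-- The value at λ₀: ‖∂*A − Δ′_aλ₀‖² = ‖(I − R)∂*A‖² (the exponent of (1.28)/(1.42) at the minimum, cf. (1.26)).
[folklore] -/
theorem norm_sq_at_lambda0 (hG : GreenData Δ q qs a g c₂) (f : E) :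
    ‖f - lapPrime Δ q qs a (lambda0 q qs g c₂ f)‖ ^ 2 = ‖P144 q qs g c₂ f‖ ^ 2 := by
  rw [residual_143 hG]

/-- λ₀ IS the minimiser over N(Q′_k) (KKT sufficiency, unsaid in print — C-adv4-33 (F2)). [folklore] -/
theorem inf_142 (hG : GreenData Δ q qs a g c₂) (hΔ : ∀ x y : E, inner ℝ (Δ x) y = inner ℝ x (Δ y))
    (hadj : ∀ (x : E) (φ : F), inner ℝ (q x) φ = inner ℝ x (qs φ)) (f l : E) (hl : q l = 0) :
    ‖P144 q qs g c₂ f‖ ^ 2 ≤ ‖f - lapPrime Δ q qs a l‖ ^ 2 := by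
  rw [norm_sq_split_142 hG hΔ hadj f l hl]
  exact le_add_of_nonneg_left (sq_nonneg _)

/-- ‖∂*A‖² = ‖(I − R)∂*A‖² + ‖R∂*A‖² (how e^{−‖R∂*A‖²/2α} arises in (1.28)/(1.39)). [folklore] -/
theorem norm_sq_eq (hG : GreenData Δ q qs a g c₂) (hΔ : ∀ x y : E, inner ℝ (Δ x) y = inner ℝ x (Δ y))
    (hadj : ∀ (x : E) (φ : F), inner ℝ (q x) φ = inner ℝ x (qs φ)) (f : E) :
    ‖f‖ ^ 2 = ‖P144 q qs g c₂ f‖ ^ 2 + ‖R144 q qs g c₂ f‖ ^ 2 := by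
  have h := norm_sq_sub_of_fix (R144_idem hG) (R144_symm hG hΔ hadj) f 0 (map_zero _)
  have hP : f - R144 q qs g c₂ f = P144 q qs g c₂ f := by rw [R144_apply, sub_sub_cancel]
  rw [sub_zero, sub_zero, hP] at h
  rw [h, add_comm]

end R144

/-! ### The two R's compared -/

section Compare

variable {one : E} {one' : F} {Δ Δi : E →ₗ[ℝ] E} {q : E →ₗ[ℝ] F} {qs : F →ₗ[ℝ] E} {ci : F →ₗ[ℝ] F}
  {a : ℝ} {g : E →ₗ[ℝ] E} {c₂ : F →ₗ[ℝ] F}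

/-- MAIN COMPARISON (G-adv4-11 (ii), C-B5-8): the operator (1.38) (with the p. 22 convention Δ⁻¹1 = 0) and the
operator (1.44), both called "the projection operator R", differ exactly by the rank-one orthogonal projector onto
the constants: R₍₁.₃₈₎ = R₍₁.₄₄₎ + π₁ on all of L²(T_η). [folklore] -/
theorem R138_eq_R144_add_proj1 (hΔ : LapData one Δ Δi) (hQ : AvgData one one' q qs) (hone : one ≠ 0)
    (hone' : one' ≠ 0) (hci : ∀ φ : F, inner ℝ one' φ = 0 → q (Δi (Δi (qs (ci φ)))) = φ)
    (hG : GreenData Δ q qs a g c₂) :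
    R138 Δi q qs ci = R144 q qs g c₂ + proj1 one := by
  have key : R138 Δi q qs ci - proj1 one = R144 q qs g c₂ := by
    apply eq_of_symm_idem_fix
    · intro x
      rw [LinearMap.sub_apply, LinearMap.sub_apply, map_sub, map_sub, R138_idem hΔ hQ hone hci,
        R138_proj1 hΔ, proj1_R138 hΔ, proj1_idem hone, sub_self, sub_zero]
    · exact R144_idem hG
    · intro x y
      rw [LinearMap.sub_apply, LinearMap.sub_apply, inner_sub_left, inner_sub_right,
        R138_symm hΔ hQ hone hci, proj1_symm]
    · exact R144_symm hG hΔ.symm hQ.adj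
    · intro x
      rw [LinearMap.sub_apply, R144_fix_iff_exists hG]
      constructor
      · intro h0
        have hP : P138 Δi q qs ci x + proj1 one x = 0 := by
          rw [R138_apply, sub_sub, sub_eq_self] at h0
          exact h0
        have hπ : inner ℝ one x = 0 := by
          have h1 : inner ℝ one (P138 Δi q qs ci x + proj1 one x) = 0 := by
            rw [hP, inner_zero_right]
          rw [inner_add_right, P138_apply, hΔ.inner_one_inv hone, zero_add, inner_one_proj1 hone] at h1
          exact h1
        have hPx : P138 Δi q qs ci x = 0 := by
          rw [proj1_eq_zero_of_inner _ _ hπ, add_zero] at hP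
          exact hP
        have hfix : R138 Δi q qs ci x = x := by rw [R138_apply, hPx, sub_zero]
        exact (R138_fix_iff_of_orth hΔ hQ hone hone' hci x hπ).mp hfix
      · rintro ⟨l, hl, rfl⟩
        rw [proj1_eq_zero_of_inner _ _ (hΔ.inner_one_lap l), sub_zero]
        exact R138_lap hΔ hQ hone hone' l hl
  rw [← key, sub_add_cancel]

/-- Pointwise form: R₍₁.₃₈₎ω = R₍₁.₄₄₎ω + (⟨1, ω⟩/⟨1, 1⟩)·1. [folklore] -/
theorem R138_apply_eq (hΔ : LapData one Δ Δi) (hQ : AvgData one one' q qs) (hone : one ≠ 0)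
    (hone' : one' ≠ 0) (hci : ∀ φ : F, inner ℝ one' φ = 0 → q (Δi (Δi (qs (ci φ)))) = φ)
    (hG : GreenData Δ q qs a g c₂) (ω : E) :
    R138 Δi q qs ci ω = R144 q qs g c₂ ω + proj1 one ω := by
  rw [R138_eq_R144_add_proj1 hΔ hQ hone hone' hci hG, LinearMap.add_apply]

/-- The two R's COINCIDE on 1^⊥ ⊇ Ran ∂* — the only place R is ever applied ((1.39), (1.46)–(1.50); B6 (2.78),
(2.107)–(2.110); B9 Sect. D), so G-adv4-11 is not load-bearing. [folklore] -/
theorem R138_eq_R144_of_orth (hΔ : LapData one Δ Δi) (hQ : AvgData one one' q qs) (hone : one ≠ 0)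
    (hone' : one' ≠ 0) (hci : ∀ φ : F, inner ℝ one' φ = 0 → q (Δi (Δi (qs (ci φ)))) = φ)
    (hG : GreenData Δ q qs a g c₂) (ω : E) (hω : inner ℝ one ω = 0) :
    R138 Δi q qs ci ω = R144 q qs g c₂ ω := by
  rw [R138_apply_eq hΔ hQ hone hone' hci hG, proj1_eq_zero_of_inner _ _ hω, add_zero]

/-- In particular on Δλ (e.g. ∂*A-type fields): R₍₁.₃₈₎Δλ = R₍₁.₄₄₎Δλ for every λ. [folklore] -/
theorem R138_lap_eq_R144_lap (hΔ : LapData one Δ Δi) (hQ : AvgData one one' q qs) (hone : one ≠ 0)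
    (hone' : one' ≠ 0) (hci : ∀ φ : F, inner ℝ one' φ = 0 → q (Δi (Δi (qs (ci φ)))) = φ)
    (hG : GreenData Δ q qs a g c₂) (l : E) :
    R138 Δi q qs ci (Δ l) = R144 q qs g c₂ (Δ l) :=
  R138_eq_R144_of_orth hΔ hQ hone hone' hci hG _ (hΔ.inner_one_lap l)

/-- … and they DIFFER on the constants: (R₍₁.₃₈₎ − R₍₁.₄₄₎)1 = 1 ≠ 0. [folklore] -/
theorem R138_sub_R144_one (hΔ : LapData one Δ Δi) (hQ : AvgData one one' q qs)
    (hG : GreenData Δ q qs a g c₂) :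
    R138 Δi q qs ci one - R144 q qs g c₂ one = one := by
  rw [R138_one hΔ, R144_one hG hΔ hQ, sub_zero]

end Compare

/-! ### Joint satisfiability of the hypothesis bundles -/

/-- The real inner product on `ℝ` is multiplication. [folklore] -/
theorem real_inner_eq_mul' (x y : ℝ) : inner ℝ x y = x * y := by
  simp [mul_comm]

/-- The four hypothesis bundles are jointly satisfiable with 1 ≠ 0 (degenerate one-point torus: E = F = ℝ,
Δ = Δ⁻¹ = 0, Q′_k = Q′_k* = I, a = 1, G′_k = (Q′_kG′_k²Q′_k*)⁻¹ = I, (Q′_kΔ⁻²Q′_k*)⁻¹ = 0); the lattice instances are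
the paper's (p. 22, p. 25), not constructed here. [folklore] -/
theorem hypotheses_satisfiable :
    ∃ (Δ Δi q qs ci g c₂ : ℝ →ₗ[ℝ] ℝ) (a : ℝ), (1 : ℝ) ≠ 0 ∧ LapData (1 : ℝ) Δ Δi ∧
      AvgData (1 : ℝ) (1 : ℝ) q qs ∧ (∀ φ : ℝ, inner ℝ (1 : ℝ) φ = 0 → q (Δi (Δi (qs (ci φ)))) = φ) ∧
      GreenData Δ q qs a g c₂ := by
  have hproj : ∀ x : ℝ, proj1 (1 : ℝ) x = x := by
    intro x
    rw [proj1_apply, real_inner_eq_mul', real_inner_eq_mul', one_mul, one_mul, div_one, smul_eq_mul, mul_one]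
  refine ⟨0, 0, LinearMap.id, LinearMap.id, 0, LinearMap.id, LinearMap.id, 1, one_ne_zero, ?_, ?_, ?_, ?_⟩
  · refine ⟨?_, ?_, ?_, ?_, ?_⟩
    · intro x y
      rw [LinearMap.zero_apply, LinearMap.zero_apply, inner_zero_left, inner_zero_right]
    · rfl
    · intro x
      simp only [LinearMap.zero_apply, hproj, sub_self]
    · intro x
      simp only [LinearMap.zero_apply, hproj, sub_self]
    · rfl
  · refine ⟨?_, ?_, ?_⟩
    · intro x φ
      rfl
    · rfl
    · intro x hx
      simpa using hx
  · intro φ hφ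
    rw [real_inner_eq_mul', one_mul] at hφ
    subst hφ
    simp
  · refine ⟨?_, ?_, ?_, ?_⟩ <;> intro x <;> simp

end Literature.MathematicalPhysics.QuantumFieldTheory.Balaban1983to89.B5Projector144
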